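/-
Copyright (c) 2026. All rights reserved.
Released under Apache 2.0 license as described in the file LICENSE.
Authors: abc-iut cell, discharge seat abc-iut-L4-t8 (wave 2).
-/
import Mathlib.Analysis.Normed.Group.Pointwise
import Mathlib.Topology.MetricSpace.Pseudo.Lemmas
import Literature.AnabelianGeometry.AbsoluteAnabelian.LocalVolumesNonarchimedean
import Literature.IUT.LogVolume.FinitelyAdditiveVolume
import Literature.AnabelianGeometry.AbsoluteAnabelian.LogIsometricUnitLog
import HarnessLib

/-!
# [AbsTopIII] Proposition 5.7 (i): proofs of the named facts of `LocalVolumesNonarchimedean.lean`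

S. Mochizuki, *Topics in absolute anabelian geometry III*, J. Math. Sci. Univ. Tokyo 22 (2015)
[MochizukiAbsTopIII2015], Prop. 5.7 (i), author's manuscript (lit key `paper:url-5493eb38cbb7`) pp. 137–139.

PROOF-ONLY companion of `Literature/AnabelianGeometry/AbsoluteAnabelian/LocalVolumesNonarchimedean.lean`
(statement file, seat abc-iut-L4-t3, p403734): it DISCHARGES the two named facts left open there,

* `LocalVolumeUnique K` — Prop. 5.7 (i)(a), uniqueness AS PRINTED: any map on `M(k)` that is additive on
  disjoint unions, `⊞`-translation invariant and normalised by `𝒪_k ↦ 1` is `μ_k`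
  (`LocalVolumeUnique_holds`);
* `LogVolumeCompatibleOfIsometric K` — the combinatorial half of Prop. 5.7 (i)(c): a map `log : k → k`
  that carries every small closed ball centred at a unit onto the closed ball of the same radius centred
  at the image ("`log_k` determines a bijection `x + 𝔪_k^n ≅ log_k(x) + 𝔪_k^n`", p. 139) satisfies
  `μ_k^log(A) = μ_k^log(log(A))` for every `A ∈ M(k)`, `A ⊆ 𝒪_k^×`, on which it is injective
  (`LogVolumeCompatibleOfIsometric_holds`),

by the text's own argument (p. 139: decompose a compact open set into finitely many cosets of a small
open subgroup `𝔪_k^n`; count cosets), which the cell's campaign-S seat abc-iut-S2 proved once for an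
arbitrary nonarchimedean abelian group with an integral structure `Λ`
(`Literature/IUT/LogVolume/FinitelyAdditiveVolume.lean`: `IntegralStructure.IsFinAddVolume.eq_haar`,
`IntegralStructure.haar_image_eq_of_coset_translate`). The only new ingredients here are the BRIDGE
between the two presentations of `μ_k` in the tree — abc-iut-L4-t3's `localHaar K` (Haar measure normalised
on the positive compact `closedBall 0 1`) and abc-iut-S2's `Λ.haar` for an integral structure `Λ` with
carrier `𝒪_k = closedBall 0 1` (e.g. `unitBallStructure K` of `Literature/IUT/LogVolume/LocalFieldVolume.lean`,
whose `Literature.IUT.LogVolume.localVolume K` is by definition `(unitBallStructure K).haar`) — which are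
EQUAL measures (`haar_eq_localHaar_of_coe_eq`; stated for every such `Λ`, so that no definition of the
campaign-S files is imported here), and the passage
from the statement file's `M(k)` (NONEMPTY compact open subsets, as a `Set (Set K)`) to Mathlib's bundled
`TopologicalSpace.CompactOpens K` (which contains `∅`; a finitely additive function is extended by `0`).

No new definitions; nothing here concerns any disputed claim (Prop. 5.7 is classical measure theory).
-/

set_option autoImplicit false

noncomputable section

open MeasureTheory MeasureTheory.Measure Set Metric TopologicalSpace
open scoped Pointwise NNReal ENNReal

namespace Literature.AnabelianGeometry.AbsoluteAnabelian

open Literature.NumberTheory.GaloisRepresentations.Ultrametric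
open Literature.IUT.LogVolume (IntegralStructure)

variable {K : Type*} [NontriviallyNormedField K] [IsUltrametricDist K] [ProperSpace K]

/-! ## The bridge: the two normalised Haar measures of the tree coincide -/

/-- The positive compact underlying an integral structure `Λ` with carrier `𝒪_k = closedBall 0 1` (abc-iut-S2's
`unitBallStructure K`) IS the positive compact normalising abc-iut-L4-t3's `localHaar` (same carrier).
[cite: MochizukiAbsTopIII2015, Prop 5.7 (i)(a)(3) p. 137] -/
theorem positiveCompacts_eq_integersPositiveCompacts_of_coe_eq (Λ : IntegralStructure K)
    (hΛ : (Λ : Set K) = closedBall (0 : K) 1) : Λ.positiveCompacts = integersPositiveCompacts K :=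
  PositiveCompacts.ext hΛ

variable [MeasurableSpace K] [BorelSpace K]

/-- **Bridge.** For an integral structure `Λ` with carrier `𝒪_k = closedBall 0 1` — abc-iut-S2's
`unitBallStructure K`, whose `Λ.haar` is the campaign-S measure `Literature.IUT.LogVolume.localVolume K` —
the `Λ`-normalised Haar measure equals abc-iut-L4-t3's `localHaar K` (both are Mathlib's `addHaarMeasure` on
the same positive compact): ONE volume `μ_k` in the tree, two names.
[cite: MochizukiAbsTopIII2015, Prop 5.7 (i)(a) p. 137] -/
theorem haar_eq_localHaar_of_coe_eq (Λ : IntegralStructure K) (hΛ : (Λ : Set K) = closedBall (0 : K) 1) :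
    Λ.haar = localHaar K := by
  unfold IntegralStructure.haar localHaar
  rw [positiveCompacts_eq_integersPositiveCompacts_of_coe_eq Λ hΛ]

/-- **Bridge**, real-valued form: t3's `μ_k(A) = localVolume K A` is the real part of S2's `Λ.haar A`
(`Λ` with carrier `𝒪_k`). [cite: MochizukiAbsTopIII2015, Prop 5.7 (i)(a) p. 137] -/
theorem localVolume_eq_haar_toReal_of_coe_eq (Λ : IntegralStructure K)
    (hΛ : (Λ : Set K) = closedBall (0 : K) 1) (A : Set K) :
    localVolume K A = (Λ.haar A).toReal := by
  rw [haar_eq_localHaar_of_coe_eq Λ hΛ]; rfl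

/-! ## Prop. 5.7 (i)(a): uniqueness of `μ_k` among finitely additive normalised invariant maps -/

open scoped Classical in
omit [ProperSpace K] [MeasurableSpace K] [BorelSpace K] in
/-- The extension by `0` (on `∅`) of a map `ν : Set K → ℝ` satisfying the printed conditions (1)(2)(3)
on the NONEMPTY compact open sets `M(k)` is a finitely additive, translation-invariant, normalised
function on Mathlib's `CompactOpens K` in the sense of abc-iut-S2's `IsFinAddVolume Λ`, for any integral
structure `Λ` with carrier `𝒪_k`.
[cite: MochizukiAbsTopIII2015, Prop 5.7 (i)(a) p. 137] -/
theorem isFinAddVolume_extend (Λ : IntegralStructure K) (hΛ : (Λ : Set K) = closedBall (0 : K) 1)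
    (ν : Set K → ℝ)
    (hadd : ∀ A ∈ compactOpens K, ∀ B ∈ compactOpens K, Disjoint A B → ν (A ∪ B) = ν A + ν B)
    (hvadd : ∀ A ∈ compactOpens K, ∀ x : K, ν (x +ᵥ A) = ν A)
    (hnorm : ν (closedBall (0 : K) 1) = 1) :
    IntegralStructure.IsFinAddVolume Λ
      (fun B : CompactOpens K => if (B : Set K).Nonempty then ν B else 0) := by
  classical
  refine ⟨?_, ?_, ?_⟩
  · intro B C hBC
    rw [CompactOpens.coe_sup]
    by_cases hB : (B : Set K).Nonempty
    · by_cases hC : (C : Set K).Nonempty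
      · have hBm : (B : Set K) ∈ compactOpens K := ⟨hB, B.isCompact, B.isOpen⟩
        have hCm : (C : Set K) ∈ compactOpens K := ⟨hC, C.isCompact, C.isOpen⟩
        rw [if_pos (hB.mono subset_union_left), if_pos hB, if_pos hC]
        exact hadd _ hBm _ hCm hBC
      · have hC' : (C : Set K) = ∅ := not_nonempty_iff_eq_empty.mp hC
        rw [if_pos hB, if_neg hC, hC', union_empty, if_pos hB, add_zero]
    · have hB' : (B : Set K) = ∅ := not_nonempty_iff_eq_empty.mp hB
      rw [if_neg hB, hB', empty_union, zero_add]
  · intro x B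
    rw [IntegralStructure.coe_translate]
    by_cases hB : (B : Set K).Nonempty
    · have hBm : (B : Set K) ∈ compactOpens K := ⟨hB, B.isCompact, B.isOpen⟩
      rw [if_pos hB, if_pos hB.vadd_set]
      exact hvadd _ hBm x
    · have hB' : (B : Set K) = ∅ := not_nonempty_iff_eq_empty.mp hB
      rw [if_neg hB, hB', Set.vadd_set_empty, if_neg Set.not_nonempty_empty]
  · rw [IntegralStructure.coe_toCompactOpens, hΛ, if_pos (nonempty_closedBall.mpr zero_le_one)]
    exact hnorm

open scoped Classical in
/-- **[AbsTopIII] Prop. 5.7 (i)(a), uniqueness — DISCHARGE of the named fact `LocalVolumeUnique`**: a map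
`ν : M(k) → ℝ` with (1) additivity on disjoint unions, (2) `⊞`-translation invariance, (3) `ν(𝒪_k) = 1`
coincides with the volume `μ_k` on `M(k)` (proof as on p. 139 of the text: every `A ∈ M(k)` — and `𝒪_k`
itself — is a finite disjoint union of cosets of one small open subgroup; abc-iut-S2's
`IsFinAddVolume.eq_haar`, transported along the bridge `haar_eq_localHaar_of_coe_eq`).
[cite: MochizukiAbsTopIII2015, Prop 5.7 (i)(a) p. 137] -/
theorem LocalVolumeUnique_holds : LocalVolumeUnique K := by
  classical
  intro ν hadd hvadd hnorm A hA
  -- the integral structure `𝒪_k` (= abc-iut-S2's `unitBallStructure K`, not imported here)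
  let Λ : IntegralStructure K := ⟨unitBall K, isCompact_closedBall (0 : K) 1⟩
  have hΛ : (Λ : Set K) = closedBall (0 : K) 1 := rfl
  have key := (isFinAddVolume_extend Λ hΛ ν hadd hvadd hnorm).eq_haar Λ ⟨⟨A, hA.2.1⟩, hA.2.2⟩
  have hAne : (((⟨⟨A, hA.2.1⟩, hA.2.2⟩ : CompactOpens K)) : Set K).Nonempty := hA.1
  rw [if_pos hAne] at key
  rw [localVolume_eq_haar_toReal_of_coe_eq Λ hΛ]
  exact key

/-! ## Prop. 5.7 (i)(c): log-compatibility from the isometry of `log_k` on small balls -/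

/-- **[AbsTopIII] Prop. 5.7 (i)(c), combinatorial half — DISCHARGE of the named fact
`LogVolumeCompatibleOfIsometric`**: if `log : k → k` maps every closed ball of radius `r ≤ r₀` centred at a
unit onto the closed ball of radius `r` centred at the image ("`log_k` determines a bijection
`x + 𝔪_k^n ≅ log_k(x) + 𝔪_k^n`"), then for every `A ∈ M(k)` contained in `𝒪_k^×` on which `log` is
injective (with `log(A) ∈ M(k)`), `μ_k^log(A) = μ_k^log(log(A))` ("it suffices [by the additivity property
of `μ_k(−)`] to verify part (c) for `A` of the form `x + 𝔪_k^n` for `n` … sufficiently large … so the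
equality … follows from the ⊞-translation invariance", p. 139). The small open subgroup is the closed
ball of radius `min(δ/2, r₀)`, `δ` a Lebesgue number of `A`; the coset count is abc-iut-S2's
`haar_image_eq_of_coset_translate`. [cite: MochizukiAbsTopIII2015, Prop 5.7 (i)(c) p. 138] -/
theorem LogVolumeCompatibleOfIsometric_holds : LogVolumeCompatibleOfIsometric (K := K) := by
  classical
  rintro log ⟨r₀, hr₀, hiso⟩ A hA hAunits hinj -
  -- a Lebesgue number `δ` of the compact `A` for the open cover `{A}`: `ball a δ ⊆ A` for all `a ∈ A`
  obtain ⟨δ, hδ, hδA⟩ := lebesgue_number_lemma_of_metric (ι := Unit) (c := fun _ => A) hA.2.1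
    (fun _ => hA.2.2) (fun a ha => mem_iUnion.mpr ⟨(), ha⟩)
  -- the small open subgroup `H = closedBall 0 r`, `r = min (δ/2) r₀`
  obtain ⟨r, hrpos, hrδ, hrr₀⟩ : ∃ r : ℝ, 0 < r ∧ r < δ ∧ r ≤ r₀ :=
    ⟨min (δ / 2) r₀, lt_min (half_pos hδ) hr₀, (min_le_left _ _).trans_lt (half_lt_self hδ),
      min_le_right _ _⟩
  have hcoset : ∀ a : K,
      a +ᵥ ((IsUltrametricDist.closedBall_openAddSubgroup K hrpos : OpenAddSubgroup K) : Set K) =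
        closedBall a r := fun a => by
    change a +ᵥ closedBall (0 : K) r = closedBall a r
    rw [vadd_closedBall_zero]
  -- its cosets through points of `A` stay inside `A`
  have hHA : ∀ a ∈ ((⟨⟨A, hA.2.1⟩, hA.2.2⟩ : CompactOpens K) : Set K),
      a +ᵥ ((IsUltrametricDist.closedBall_openAddSubgroup K hrpos : OpenAddSubgroup K) : Set K) ⊆
        ((⟨⟨A, hA.2.1⟩, hA.2.2⟩ : CompactOpens K) : Set K) := by
    intro a ha
    obtain ⟨-, hball⟩ := hδA a ha
    rw [hcoset]
    exact (closedBall_subset_ball hrδ).trans hball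
  -- `log` carries each such coset onto the coset through the image (the isometry hypothesis; `A ⊆ 𝒪_k^×`)
  have hg : ∀ a ∈ ((⟨⟨A, hA.2.1⟩, hA.2.2⟩ : CompactOpens K) : Set K),
      log '' (a +ᵥ ((IsUltrametricDist.closedBall_openAddSubgroup K hrpos : OpenAddSubgroup K) : Set K)) =
        log a +ᵥ ((IsUltrametricDist.closedBall_openAddSubgroup K hrpos : OpenAddSubgroup K) : Set K) := by
    intro a ha
    rw [hcoset, hcoset]
    exact hiso a (hAunits ha) r hrpos hrr₀
  -- count cosets (abc-iut-S2), then transport along the bridge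
  let Λ : IntegralStructure K := ⟨unitBall K, isCompact_closedBall (0 : K) 1⟩
  have hΛ : (Λ : Set K) = closedBall (0 : K) 1 := rfl
  have key := Λ.haar_image_eq_of_coset_translate ⟨⟨A, hA.2.1⟩, hA.2.2⟩ _ hHA log hinj hg
  have key' : localVolume K (log '' A) = localVolume K A := by
    rw [localVolume_eq_haar_toReal_of_coe_eq Λ hΛ, localVolume_eq_haar_toReal_of_coe_eq Λ hΛ]
    exact congrArg ENNReal.toReal key
  rw [localLogVolume, localLogVolume, key']

/-! ## Appendix (append-only): `μ_k` is intrinsic — invariance under isometric additive isomorphisms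

A direct APPLICATION of the uniqueness AS PRINTED (`LocalVolumeUnique_holds`): for an isometric additive
isomorphism `e : k ⥲ k'` of local fields (e.g. any isomorphism of topological fields between MLFs, which
preserves the normalised absolute value), `A ↦ μ_{k'}(e(A))` satisfies (1)(2)(3) on `M(k)`, hence IS `μ_k`.
This is the second conjunct of the [IUTchIII] Prop 1.2 (iii) predicate `LogLinkVolumeCompatible` of
`Literature/IUT/LogThetaLattice/HolomorphicLogShells.lean` (abc-iut-L6-t3) for isometric `e`. -/

section Isometry

variable {K' : Type*} [NontriviallyNormedField K'] [IsUltrametricDist K'] [ProperSpace K']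

omit [IsUltrametricDist K] [ProperSpace K] [MeasurableSpace K] [BorelSpace K] [IsUltrametricDist K']
  [ProperSpace K'] in
/-- An isometric additive isomorphism maps `𝒪_k = closedBall 0 1` onto `𝒪_{k'}`.
[cite: MochizukiAbsTopIII2015, Prop 5.7 (i)(a)(3) p. 137] -/
theorem image_closedBall_zero_of_isometry (e : K ≃+ K') (he : Isometry e) (r : ℝ) :
    e '' closedBall (0 : K) r = closedBall (0 : K') r := by
  have h := (IsometryEquiv.mk e.toEquiv he).image_closedBall 0 r
  have h0 : (IsometryEquiv.mk e.toEquiv he) 0 = 0 := map_zero e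
  rw [h0] at h
  exact h

omit [IsUltrametricDist K] [ProperSpace K] [MeasurableSpace K] [BorelSpace K] [IsUltrametricDist K']
  [ProperSpace K'] in
/-- An isometric additive isomorphism carries `M(k)` into `M(k')` (nonempty compact open sets to nonempty
compact open sets). [cite: MochizukiAbsTopIII2015, Prop 5.7 (i)(a) p. 137] -/
theorem image_mem_compactOpens_of_isometry (e : K ≃+ K') (he : Isometry e) {A : Set K}
    (hA : A ∈ compactOpens K) : e '' A ∈ compactOpens K' :=
  ⟨hA.1.image _, hA.2.1.image he.continuous,
    (IsometryEquiv.mk e.toEquiv he).toHomeomorph.isOpenMap _ hA.2.2⟩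

omit [IsUltrametricDist K] [ProperSpace K] [MeasurableSpace K] [BorelSpace K] [IsUltrametricDist K']
  [ProperSpace K'] in
/-- An additive isomorphism commutes with translation of subsets: `e(x + A) = e(x) + e(A)`.
[cite: MochizukiAbsTopIII2015, Prop 5.7 (i)(a)(2) p. 137] -/
theorem image_vadd_of_addEquiv (e : K ≃+ K') (x : K) (A : Set K) :
    e '' (x +ᵥ A) = e x +ᵥ (e '' A) := by
  ext y
  simp only [Set.mem_image, Set.mem_vadd_set, vadd_eq_add]
  constructor
  · rintro ⟨_, ⟨a, ha, rfl⟩, rfl⟩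
    exact ⟨e a, ⟨a, ha, rfl⟩, (map_add e x a).symm⟩
  · rintro ⟨_, ⟨a, ha, rfl⟩, rfl⟩
    exact ⟨x + a, ⟨a, ha, rfl⟩, map_add e x a⟩

variable [MeasurableSpace K'] [BorelSpace K']

/-- **`μ_k` is intrinsic** (a consequence of Prop. 5.7 (i)(a), uniqueness): for an isometric additive
isomorphism `e : k ⥲ k'` and every `A ∈ M(k)`, `μ_{k'}(e(A)) = μ_k(A)` — the map `A ↦ μ_{k'}(e(A))` is
additive, translation invariant and normalised on `M(k)`, so it is `μ_k` by `LocalVolumeUnique_holds`.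
[cite: MochizukiAbsTopIII2015, Prop 5.7 (i)(a) p. 137] -/
theorem localVolume_image_of_isometry (e : K ≃+ K') (he : Isometry e) {A : Set K}
    (hA : A ∈ compactOpens K) : localVolume K' (e '' A) = localVolume K A := by
  refine LocalVolumeUnique_holds (K := K) (fun B => localVolume K' (e '' B)) ?_ ?_ ?_ A hA
  · intro B hB C hC hBC
    rw [Set.image_union]
    exact localVolume_union (image_mem_compactOpens_of_isometry e he hB)
      (image_mem_compactOpens_of_isometry e he hC) ((Set.disjoint_image_iff e.injective).mpr hBC)
  · intro B _ x
    rw [image_vadd_of_addEquiv, localVolume_vadd]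
  · rw [image_closedBall_zero_of_isometry e he, localVolume_closedBall_one]

/-- Log form: `μ^log_{k'}(e(A)) = μ^log_k(A)` for `A ∈ M(k)` and `e : k ⥲ k'` an isometric additive
isomorphism. [cite: MochizukiAbsTopIII2015, Prop 5.7 (i)(a) p. 137] -/
theorem localLogVolume_image_of_isometry (e : K ≃+ K') (he : Isometry e) {A : Set K}
    (hA : A ∈ compactOpens K) : localLogVolume K' (e '' A) = localLogVolume K A := by
  rw [localLogVolume, localLogVolume, localVolume_image_of_isometry e he hA]

end Isometry

/-! ## Appendix (append-only): Prop. 5.7 (i)(c) AS PRINTED, at the real logarithm `log_k = log_p`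

Composition of the two halves now in the tree: the analytic input `isIsometricOnSmallBalls_unitLog`
(`LogIsometricUnitLog.lean`, seat abc-iut-L3-t11, at abc-iut-S1's `unitLog = log_p`) and the combinatorial
half `LogVolumeCompatibleOfIsometric_holds` above. -/

section UnitLog

open Literature.IUT.LogVolume

/-- **[AbsTopIII] Prop. 5.7 (i)(c) for the real `p`-adic logarithm, UNCONDITIONAL**: for every compact
open `A ⊆ 𝒪_k^×` on which `log_k` (abc-iut-S1's `unitLog`, extended by junk values off the units) is
injective, with `log_k(A)` compact open, `μ_k^log(A) = μ_k^log(log_k(A))` — i.e. the predicate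
`LogVolumeCompatible unitLog` of the statement file holds outright (abc-iut-L3-t11's conditional
`logVolumeCompatible_unitLog_of` fed with `LogVolumeCompatibleOfIsometric_holds`).
[cite: MochizukiAbsTopIII2015, Prop 5.7 (i)(c) p. 138] -/
theorem logVolumeCompatible_unitLog (p : ℕ) [Fact p.Prime] {L : Type*} [NontriviallyNormedField L]
    [NormedAlgebra ℚ_[p] L] [IsUltrametricDist L] [ProperSpace L] [MeasurableSpace L] [BorelSpace L] :
    LogVolumeCompatible (unitLog : L → L) :=
  logVolumeCompatible_unitLog_of p LogVolumeCompatibleOfIsometric_holds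

end UnitLog

end Literature.AnabelianGeometry.AbsoluteAnabelian

end
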